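import Summits.ResolutionOfSingularities.ResolutionOfSingularities.Theorems.MarkedTransferCampaignG1PnegaInterfaceV3
import Literature.AlgebraicGeometry.Hironaka2017.S11CoordFree.R072Tau
import HarnessLib

/-!
# [OURS · L1 G1 ℘nega-INTERFACE] Obligation **F3.4** — the Rem. 11.4 crossing instance (p.63 L31–L33) read degree-wise —
# over the checklist of record `Campaign.PnegaInterfaceV3` (p487629). Data-level `def` by res-type-072 (res-D-plan-1 ROUTING #8 (c2)
# 2026-08-27T02:04:02Z; scratch `D/res-type-072/InterfaceV3Regression.lean` §4 `ObligationF34`, sha16 140f20a2d8644f99, farm-clean),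
# carried summit-side by the typer of record res-L1-type-o2 (namespace `…Campaign.PnegaObligation` like F3.1–F3.3; the four curried
# guard hypotheses ↦ ONE hypothesis `Campaign.IsCharFiltration K P`; + §2 `PnegaInterfaceV3.F34`); statement otherwise byte-identical.
# The regression KERNELS of the same scratch file (E-E / E-F / E-D and `negPieces_eq_top_of_F34`, `F34_regression_affineLine`) are
# res-type-072's to land (`Theorems/MarkedTransferCampaignG1PnegaRegression.lean`, kind proof; their TREE PLAN 02:56:10Z) — they are
# stated over a bare family `N` with the F3.4 clause INLINED, so they do not depend on this file; this file does not restate them.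

WHY A SEPARATE OBLIGATION (res-adj-1 ℘nega-INTERFACE CHECK 2026-08-27T01:41:03Z C1, ADOPTED by res-D-plan-1's V3 RULING 01:55:32Z):
the V3 structure keeps only F3⁻ `diff_mem_neg` (Diff-stability from NEGATIVE source degrees); the CONSUMED crossing instances F3.1
(Th 7.11 (1), `…ObligationF31.lean` p489208), F3.2 (Th 14.1 proof, `…ObligationF32.lean` p489343), F3.3 (§9.3 `⊟ ⊂ ℘̃`,
`…ObligationF33.lean` p489269) and F3.4 (Rem 11.4, THIS file) are SEPARATE named obligation `def`s over the structure, each with the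
consumer's own source / operator family, scored N/A until typed.

WHAT THE PAGE CONSUMES (locators by res-type-072 on `lit/layout/p0062.txt`, `p0063.txt`). «Remark 11.4. If `X ⊂ ℘̃(Ě)` then
`(Diff*_{Z/Z(p^i)} X)(Diff_Z X)` is contained in `℘̃(Ě)` because this is a Diff-product of `X ⊂ ℘̃(Ě)`» (p.63 l.38–47 = layout
L31–L33), consumed by Prop. 11.7 (1) p.64 L17–L18 through `Λ_{e−i} X = X + (Diff*_{Z/Z(p^i)} X)(Diff_Z X)` (Eq. (94) p.63 L30–L37)
— i.e. the binder `habs : ∀ i X, X ≤ ℘̃ → diffProd i X ≤ ℘̃` of `S11CoordFree.Rem11_4_of_absorbs` / `hRem11_4` of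
`Lambda_le_of_Rem11_4`, `Prop11_7_1_blSub_of_Rem11_4`, `Prop11_7_instZ_1_of_Rem11_4` (`Proofs/S11CoordFree/Rem11p4`, Prop117d
p479341, Prop117InstZ p483148). READ DEGREE-WISE on a bare tilde family over the base ring `B = 𝒪_Z(V)`: with row 073's convention
that an operator of DECLARED order `μ` acts in degree `μ` (`diffShift`, `diffImage`), a homogeneous generator
`(D x·T^{d−μ})(D' x'·T^{d'−μ'})` of `(Diff*_{Z/Z(p^i)} X)(Diff_Z X)` for `X = ⟨x T^d, x' T^{d'}⟩ ⊂ ℘̃` lies in `℘̃` iff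
`D x · D' x' ∈ ℘̃(d − μ + d' − μ')`; the first factor ranges over `Diff*_{Z/Z(p^i)}` = row 072's `S11CoordFree.diffStarFrob K B p i`
(«those `∂` having `∂ρ^i(𝒪) = (0)`», p.62 l.47–50) with a declared order `μ`, the second over all of `Diff_Z` with a declared order
`μ'`; SOURCE degrees `d, d'` are UNRESTRICTED (`X ⊂ ℘̃` arbitrary in the print).

DISTINCTION FROM F3.2 (res-type-086, `…ObligationF32.lean`): F3.2 is the CHAIN-RESTRICTED (post-`τ`) demand of Th 14.1's proof —
members of the glued chain (104) only — and is implied by F3.4 + `τ Y ≤ Y` + `σ X ≤ X`; F3.4 is the BLANKET absorption for every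
sub-object `X ⊂ ℘̃`. KERNEL FINDING of record (res-type-072, scratch §4, offered to res-adj-1 / res-D-plan-1, NOT a ruling and NOT
restated here): as a BLANKET obligation (any exponent `i ≥ 1`, unrestricted source degrees) F3.4 replays the negative-part collapse —
`negPieces_eq_top_of_F34`: F3.4 at ONE `i` + F3⁻ + a degree-one coordinate pair (`x ∈ N 1`, `D ∈ Diff*_{Z/Z(p^i)}` of order `≤ 1`,
`D x = 1`) ⇒ `N (−a) = ⊤` for all `a ≥ 2`, realised on `K[x]`, `char K = p`, `i = 1`, `D = ∂/∂x` (`F34_regression_affineLine`); the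
printed regime has `i ≤ e` with `p^e = q_r(ξ)` (Eq. (93) p.62) — whether F3.4 is demanded for all `i` or for `i ≤ e(P)`, and whether
the sources are restricted to the `𝔏`-chain members (= F3.2), is the G1 lead's wording. res-type-086's MECHANISM NOTE (F32 file
header) points the same way. This file types the LITERAL blanket reading, as drafted; a restricted sibling is a later append.

HONEST FRAMING. Nothing here is a statement of H. Hironaka's manuscript *Resolution of singularities in positive characteristics*
(2017-03-23, [Hironaka2017], lit key `paper:url-3343fd9e678b`): Rem 11.4 is a CANDIDATE [claim: Hironaka2017, status: under-review]
and enters only as the SHAPE of an obligation; every `def` here is OURS, asserted of no candidate. AI typing, weaker than expert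
review; nothing here is progress on resolution of singularities in positive characteristic; no claim beyond the kernel.
-/

noncomputable section

set_option linter.dupNamespace false -- mandated namespace of this single-conjunct summit

namespace Summit.ResolutionOfSingularities.ResolutionOfSingularities.Theorems.Campaign

open Literature.AlgebraicGeometry.Resolution
open Literature.AlgebraicGeometry.Hironaka2017
open Literature.AlgebraicGeometry.Hironaka2017.S11CoordFree (diffStarFrob)

universe u v

namespace PnegaObligation

/-! ## §1 The obligation F3.4 (data level) -/

/-- [OURS · L1 G1 ℘nega-INTERFACE · obligation F3.4, DATA LEVEL] replaces the role of Rem. 11.4 (p.63 L31–L33) «if `X ⊂ ℘̃(Ě)`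
then `(Diff*_{Z/Z(p^i)} X)(Diff_Z X) ⊂ ℘̃(Ě)`» — the binder `habs` / `hRem11_4` of `S11CoordFree.Rem11_4_of_absorbs`,
`Lambda_le_of_Rem11_4`, `Prop11_7_1_blSub_of_Rem11_4`, `Prop11_7_instZ_1_of_Rem11_4` — for a CANDIDATE family `tilde`, read
DEGREE-WISE under row 073's declared-order convention: at every placement `B` of characteristic `p` and every guarded filtration `P`
(`Campaign.IsCharFiltration K P`), for every exponent `i`, declared orders `μ, μ'`, operators `D ∈ Diff*_{Z/Z(p^i)}` (row 072
`diffStarFrob K B p i`) of order `≤ μ` and `D'` of order `≤ μ'`, and elements `x ∈ tilde P d`, `x' ∈ tilde P d'` of ANY degrees,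
`D x · D' x' ∈ tilde P (d − μ + (d' − μ'))`. Statement = res-type-072's `ObligationF34` (scratch 140f20a2d8644f99 §4) with the four
curried guard hypotheses packaged as `IsCharFiltration K P`. Bridge to `hRem11_4` at `(CoordFreeDatum.ptildeBl, diffImage …)` needs
only «`ptildeBl` = graded `ρ^ℓ(𝒪)`-span of the pieces» (row 075 `GrFam.toBlSub`) — not typed here. NOT a statement of the
manuscript; asserted of no candidate. VACUITY: genuine and, as a BLANKET demand, lethal with F3⁻ + F7b-unit at any degree-one
coordinate pair (res-type-072 `negPieces_eq_top_of_F34` / `F34_regression_affineLine`, kind-proof file of theirs); met by the top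
candidate `fun _ _ => ⊤`. [folklore] -/
def F34 (K : Type u) [CommRing K] (p : ℕ) [Fact p.Prime]
    (tilde : ∀ {B : Type v} [CommRing B] [Algebra K B], (ℕ → Ideal B) → ℤ → AddSubgroup B) : Prop :=
  ∀ {B : Type v} [CommRing B] [Algebra K B] [CharP B p] (P : ℕ → Ideal B), IsCharFiltration K P →
    ∀ (i μ μ' : ℕ) (D D' : B →ₗ[K] B), D ∈ diffStarFrob K B p i → IsDiffOpLE K μ D → IsDiffOpLE K μ' D' →
      ∀ (d d' : ℤ) (x x' : B), x ∈ tilde P d → x' ∈ tilde P d' → D x * D' x' ∈ tilde P (d - μ + (d' - μ'))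

/-- **F3.4 at one placement in res-type-072's INLINED shape.** `F34` delivers, at every guarded `P` of a characteristic-`p`
placement and every exponent `i`, exactly the hypothesis `hF34` of res-type-072's regression kernels `negPieces_eq_top_of_F34` /
`one_mem_negPiece_of_F34` (bare family `N := tilde P`) — so those kernels apply to any candidate meeting `F34` without further glue.
[folklore] -/
theorem F34.at {K : Type u} [CommRing K] {p : ℕ} [Fact p.Prime]
    {tilde : ∀ {B : Type v} [CommRing B] [Algebra K B], (ℕ → Ideal B) → ℤ → AddSubgroup B} (hF : F34 K p tilde)
    {B : Type v} [CommRing B] [Algebra K B] [CharP B p] (P : ℕ → Ideal B) (hP : IsCharFiltration K P) (i : ℕ) :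
    ∀ (μ μ' : ℕ) (D D' : B →ₗ[K] B), D ∈ diffStarFrob K B p i → IsDiffOpLE K μ D → IsDiffOpLE K μ' D' →
      ∀ (d d' : ℤ) (x x' : B), x ∈ tilde P d → x' ∈ tilde P d' → D x * D' x' ∈ tilde P (d - μ + (d' - μ')) :=
  fun μ μ' D D' hD hμ hμ' d d' x x' hx hx' => hF P hP i μ μ' D D' hD hμ hμ' d d' x x' hx hx'

/-- Satisfiability at data level: the candidate that puts everything in every piece meets F3.4 (of course it fails F7b-unit).
[folklore] -/
theorem F34_top (K : Type u) [CommRing K] (p : ℕ) [Fact p.Prime] :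
    F34 K p (fun {B} [CommRing B] [Algebra K B] (_ : ℕ → Ideal B) (_ : ℤ) => (⊤ : AddSubgroup B)) := by
  intro B _ _ _ P _ i μ μ' D D' _ _ _ d d' x x' _ _
  exact AddSubgroup.mem_top _

end PnegaObligation

/-! ## §2 Over the checklist of record: `PnegaInterfaceV3.F34` (typer res-L1-type-o2) -/

namespace PnegaInterfaceV3

variable {K : Type u} [CommRing K] {p : ℕ} [Fact p.Prime] {prov : PnegaProvenance.{u, v} K}

/-- [OURS · L1 G1 ℘nega-INTERFACE · obligation F3.4 over V3] replaces the role of Rem. 11.4's blanket absorption «`X ⊂ ℘̃ ⇒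
(Diff*_{Z/Z(p^i)} X)(Diff_Z X) ⊂ ℘̃`» (p.63 L31–L33; binder `habs` / `hRem11_4` of the S11 proofs) as a SCORED OBLIGATION on an
inhabitant `I` of the checklist `PnegaInterfaceV3` (res-D-plan-1 V3 RULING 01:55:32Z C1): `PnegaObligation.F34 K p I.tilde`. NOT a
structure field, NOT a statement of the manuscript, asserted of no candidate; the LITERAL blanket reading (all `i`, all source
degrees) — by res-type-072's kernel it replays the collapse against the structure's own F3⁻ + F7b-unit wherever a degree-one
coordinate pair exists, so the in-regime restriction (`i ≤ e(P)`, chain-restricted sources = F3.2) is where the discriminating content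
will sit; recorded, not decided here. [folklore] -/
def F34 (I : PnegaInterfaceV3 K p prov) : Prop :=
  PnegaObligation.F34 K p I.tilde

/-- Unfolding anchor (by `Iff.rfl`). [folklore] -/
theorem F34_iff (I : PnegaInterfaceV3 K p prov) : I.F34 ↔ PnegaObligation.F34 K p I.tilde :=
  Iff.rfl

omit [Fact p.Prime] in
/-- The structure supplies the second hypothesis of res-type-072's regression kernel for free: at a guarded `P`, V3's field
`diff_mem_neg` IS the `hdiff` clause of `negPieces_eq_top_of_F34` for `N := I.tilde P` (pointer lemma, so that «F3.4 ✓ ⇒ collapse»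
is one application away for every inhabitant once a degree-one coordinate pair is exhibited at `P`). [folklore] -/
theorem hdiff_of_diff_mem_neg (I : PnegaInterfaceV3 K p prov) {B : Type v} [CommRing B] [Algebra K B] (P : ℕ → Ideal B)
    (hP : IsCharFiltration K P) :
    ∀ (μ : ℕ) (D : B →ₗ[K] B), IsDiffOpLE K μ D → ∀ i : ℤ, i < 0 → ∀ f : B, f ∈ I.tilde P i → D f ∈ I.tilde P (i - μ) :=
  fun μ D hD i hi f hf => I.diff_mem_neg P hP μ D hD i hi f hf

end PnegaInterfaceV3

end Summit.ResolutionOfSingularities.ResolutionOfSingularities.Theorems.Campaign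

end
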